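import Mathlib
import Literature.Probability.LatticeModels.TorusFourier
import Literature.NumberTheory.LFunctions.RobertSargosTheorem1
import HarnessLib

/-!
# Slice order of the anisotropic XY torus (route BalabanIR, support item `BirSliceXYOrderRP`):
# V. The Riemann sum of the anisotropic infrared bound

Self-contained fifth file of the proof of `…Theses.BalabanIR.BirSliceXYOrderRP`. The infrared bound
controls the defect of equal-time slice order on `(ℤ/L)² × (ℤ/M)` by `(K L² M)⁻¹ ∑_{k ≠ 0} ∑_q ε(k,q)⁻¹`,
`ε(k,q) = ∑ᵢ(1 - cos 2πkᵢ/L) + (1 - cos 2πq/M)`, over momenta with NONZERO spatial part `k` only.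
We prove `∑_{k ≠ 0} ∑_q ε(k,q)⁻¹ ≤ 32 L² M` for `L ≤ M` (`dispersion_sum_bound`): Jordan's inequality
(Mathlib's `Real.cos_le_one_sub_mul_cos_sq`) gives `1 - cos(2πt/n) ≥ 4 min(t,n-t)²/n²`; the sum over
`q` telescopes, `∑_q (a + 1 - cos 2πq/M)⁻¹ ≤ a⁻¹ + 2M a^{-1/2}`; the spatial sums of `|k|_∞⁻¹`
factorise after `max(m₀,m₁)⁻¹ ≤ m₀^{-1/2} m₁^{-1/2}` (the tree's `RobertSargos.Thm1.sum_inv_sqrt_le`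
gives `∑_{j<n}(j+1)^{-1/2} ≤ 2√n`). Constants are crude. Reference for the role of
this Riemann sum: Friedli–Velenik 2017, §10.5.2, (10.41) and Thm. 10.25. [FriedliVelenik2017]
-/
noncomputable section

namespace Summit.HubbardSuperconductivity.HubbardSuperconductivity.Theorems

namespace BirSliceXY

open Finset Real Literature.Probability.LatticeModels

/-! ### One-dimensional estimates -/

/-- **Jordan's inequality on the lattice**: `4t²/n² ≤ 1 - cos(2πt/n)` for `0 ≤ t ≤ n/2`
(from `cos x ≤ 1 - 2x²/π²` on `|x| ≤ π`, which gives even `8t²/n²`). [folklore] -/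
theorem four_mul_sq_div_le_one_sub_cos {n : ℕ} (hn : 0 < n) {t : ℕ} (ht : 2 * t ≤ n) :
    4 * (t : ℝ) ^ 2 / (n : ℝ) ^ 2 ≤ 1 - Real.cos (2 * π * t / n) := by
  have hn' : (0 : ℝ) < n := by exact_mod_cast hn
  have ht' : (2 * t : ℝ) ≤ n := by exact_mod_cast ht
  have hx : |2 * π * (t : ℝ) / n| ≤ π := by
    rw [abs_of_nonneg (by positivity), div_le_iff₀ hn']; nlinarith [Real.pi_pos]
  have h := Real.cos_le_one_sub_mul_cos_sq hx
  have hπ : (π : ℝ) ^ 2 ≠ 0 := by positivity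
  have heq : 2 / π ^ 2 * (2 * π * (t : ℝ) / n) ^ 2 = 8 * (t : ℝ) ^ 2 / (n : ℝ) ^ 2 := by
    field_simp; ring
  have hle : 4 * (t : ℝ) ^ 2 / (n : ℝ) ^ 2 ≤ 8 * (t : ℝ) ^ 2 / (n : ℝ) ^ 2 :=
    div_le_div_of_nonneg_right (by nlinarith [sq_nonneg (t : ℝ)]) (by positivity)
  linarith

/-- `cos(2π(n - t)/n) = cos(2πt/n)`. [folklore] -/
theorem cos_two_pi_mul_sub_div {n : ℕ} (hn : 0 < n) {t : ℕ} (ht : t ≤ n) :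
    Real.cos (2 * π * ((n - t : ℕ) : ℝ) / n) = Real.cos (2 * π * t / n) := by
  have hn' : (n : ℝ) ≠ 0 := by exact_mod_cast hn.ne'
  rw [Nat.cast_sub ht]
  have : 2 * π * ((n : ℝ) - t) / n = 2 * π - 2 * π * t / n := by field_simp
  rw [this, Real.cos_two_pi_sub]

/-- The symmetric form of Jordan's inequality on `ℤ/n`: `4m²/n² ≤ 1 - cos(2πv/n)` with
`m = min(v, n - v)` the distance of the representative `v ∈ {0,…,n-1}` to `nℤ`. [folklore] -/
theorem four_mul_sq_min_div_le {n : ℕ} (hn : 0 < n) {t : ℕ} (ht : t < n) :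
    4 * ((min t (n - t) : ℕ) : ℝ) ^ 2 / (n : ℝ) ^ 2 ≤ 1 - Real.cos (2 * π * t / n) := by
  rcases le_or_gt (2 * t) n with h | h
  · rw [min_eq_left (by omega)]
    exact four_mul_sq_div_le_one_sub_cos hn h
  · rw [min_eq_right (by omega), ← cos_two_pi_mul_sub_div hn ht.le]
    exact four_mul_sq_div_le_one_sub_cos hn (by omega)

/-- Pointwise bound for the reciprocal dispersion along one direction:
`(a + 1 - cos 2πt/n)⁻¹ ≤ (a + 4t²/n²)⁻¹ + (a + 4(n-t)²/n²)⁻¹` (`a > 0`, `0 ≤ t < n`; one of the two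
terms is the Jordan bound, the other is nonnegative). [folklore] -/
theorem inv_add_one_sub_cos_le {n : ℕ} (hn : 0 < n) {a : ℝ} (ha : 0 < a) {t : ℕ} (ht : t < n) :
    1 / (a + (1 - Real.cos (2 * π * t / n))) ≤
      1 / (a + 4 * (t : ℝ) ^ 2 / (n : ℝ) ^ 2) + 1 / (a + 4 * ((n - t : ℕ) : ℝ) ^ 2 / (n : ℝ) ^ 2) := by
  have hpos1 : 0 < a + 4 * (t : ℝ) ^ 2 / (n : ℝ) ^ 2 := by positivity
  have hpos2 : 0 < a + 4 * ((n - t : ℕ) : ℝ) ^ 2 / (n : ℝ) ^ 2 := by positivity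
  rcases le_or_gt (2 * t) n with h2 | h2
  · have hc := four_mul_sq_div_le_one_sub_cos hn h2
    calc 1 / (a + (1 - Real.cos (2 * π * t / n))) ≤ 1 / (a + 4 * (t : ℝ) ^ 2 / (n : ℝ) ^ 2) :=
          one_div_le_one_div_of_le hpos1 (by linarith)
      _ ≤ _ := le_add_of_nonneg_right (one_div_nonneg.2 hpos2.le)
  · have hc := four_mul_sq_div_le_one_sub_cos hn (by omega : 2 * (n - t) ≤ n)
    rw [cos_two_pi_mul_sub_div hn ht.le] at hc
    calc 1 / (a + (1 - Real.cos (2 * π * t / n))) ≤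
        1 / (a + 4 * ((n - t : ℕ) : ℝ) ^ 2 / (n : ℝ) ^ 2) :=
          one_div_le_one_div_of_le hpos2 (by linarith)
      _ ≤ _ := le_add_of_nonneg_left (one_div_nonneg.2 hpos1.le)

/-- **The telescoping sum**: `∑_{j<n} (s² + r²(j+1)²)⁻¹ ≤ 2/(rs) - 2/(r(s + rn))` for `r, s > 0`,
by induction: each term is at most `2/((s + rj)(s + r(j+1)))`. [folklore] -/
theorem sum_range_inv_sq_add_le {s r : ℝ} (hs : 0 < s) (hr : 0 < r) (n : ℕ) :
    ∑ j ∈ Finset.range n, 1 / (s ^ 2 + r ^ 2 * ((j : ℝ) + 1) ^ 2) ≤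
      2 / (r * s) - 2 / (r * (s + r * n)) := by
  induction n with
  | zero => simp
  | succ n ih =>
    rw [Finset.sum_range_succ]
    have hA : 0 < s + r * n := by positivity
    have hB : 0 < s + r * ((n : ℝ) + 1) := by positivity
    have hstep : 1 / (s ^ 2 + r ^ 2 * ((n : ℝ) + 1) ^ 2) ≤
        2 / (r * (s + r * n)) - 2 / (r * (s + r * ((n : ℝ) + 1))) := by
      have hAB : 2 / (r * (s + r * n)) - 2 / (r * (s + r * ((n : ℝ) + 1))) =
          2 / ((s + r * n) * (s + r * ((n : ℝ) + 1))) := by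
        field_simp; ring
      rw [hAB, div_le_div_iff₀ (by positivity) (by positivity)]
      nlinarith [sq_nonneg (2 * s - r * (2 * n + 1)), mul_pos hr hs, sq_nonneg r]
    push_cast at ih ⊢
    linarith

/-- `∑_{j<n} (s² + r²(j+1)²)⁻¹ ≤ 2/(rs)`. [folklore] -/
theorem sum_range_inv_sq_add_le' {s r : ℝ} (hs : 0 < s) (hr : 0 < r) (n : ℕ) :
    ∑ j ∈ Finset.range n, 1 / (s ^ 2 + r ^ 2 * ((j : ℝ) + 1) ^ 2) ≤ 2 / (r * s) :=
  (sum_range_inv_sq_add_le hs hr n).trans (sub_le_self _ (by positivity))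

/-- A sum over `ℤ/n` of a function of the representative is a sum over `{0, …, n-1}`. [folklore] -/
theorem sum_zmod_eq_sum_range {n : ℕ} [NeZero n] {A : Type*} [AddCommMonoid A] (F : ℕ → A) :
    ∑ v : ZMod n, F v.val = ∑ t ∈ Finset.range n, F t := by
  have h1 : (Finset.univ : Finset (ZMod n)).image ZMod.val = Finset.range n := by
    ext t
    simp only [Finset.mem_image, Finset.mem_univ, true_and, Finset.mem_range]
    exact ⟨fun ⟨v, hv⟩ => hv ▸ ZMod.val_lt v, fun ht => ⟨(t : ZMod n), ZMod.val_cast_of_lt ht⟩⟩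
  rw [← h1, Finset.sum_image fun x _ y _ h => ZMod.val_injective n h]

/-- **The one-dimensional sum of the reciprocal dispersion**: for `a > 0`,
`∑_{v ∈ ℤ/n} (a + 1 - cos 2πv/n)⁻¹ ≤ a⁻¹ + 2n/√a` (uniformly in `n`; the `M ≫ L²` regime of the
item is harmless precisely because of the `√a` here). [folklore] -/
theorem sum_inv_add_one_sub_cos_le {n : ℕ} [NeZero n] {a : ℝ} (ha : 0 < a) :
    ∑ v : ZMod n, 1 / (a + (1 - Real.cos (2 * π * (v.val : ℝ) / n))) ≤
      1 / a + 2 * n / Real.sqrt a := by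
  have hn : 0 < n := Nat.pos_of_ne_zero (NeZero.ne n)
  have hn' : (0 : ℝ) < n := by exact_mod_cast hn
  have hsa : 0 < Real.sqrt a := Real.sqrt_pos.2 ha
  rw [sum_zmod_eq_sum_range (fun t => 1 / (a + (1 - Real.cos (2 * π * (t : ℝ) / n))))]
  have hpt : ∀ t ∈ Finset.range n, 1 / (a + (1 - Real.cos (2 * π * (t : ℝ) / n))) ≤
      1 / (a + 4 * (t : ℝ) ^ 2 / (n : ℝ) ^ 2) + 1 / (a + 4 * ((n - t : ℕ) : ℝ) ^ 2 / (n : ℝ) ^ 2) :=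
    fun t ht => inv_add_one_sub_cos_le hn ha (Finset.mem_range.1 ht)
  refine (Finset.sum_le_sum hpt).trans ?_
  rw [Finset.sum_add_distrib]
  -- the common form `s² + r²x²` with `s = √a`, `r = 2/n`
  have hform : ∀ x : ℝ, a + 4 * x ^ 2 / (n : ℝ) ^ 2 = Real.sqrt a ^ 2 + (2 / n) ^ 2 * x ^ 2 := by
    intro x
    rw [Real.sq_sqrt ha.le]; field_simp; ring
  have hrs : 2 / (2 / (n : ℝ) * Real.sqrt a) = n / Real.sqrt a := by field_simp
  -- second sum, reflected: `n - t = j + 1`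
  have hrefl : ∑ t ∈ Finset.range n, 1 / (a + 4 * ((n - t : ℕ) : ℝ) ^ 2 / (n : ℝ) ^ 2) =
      ∑ j ∈ Finset.range n, 1 / (Real.sqrt a ^ 2 + (2 / n) ^ 2 * ((j : ℝ) + 1) ^ 2) := by
    rw [← Finset.sum_range_reflect (fun j => 1 / (Real.sqrt a ^ 2 + (2 / n) ^ 2 * ((j : ℝ) + 1) ^ 2)) n]
    refine Finset.sum_congr rfl fun t ht => ?_
    have ht' := Finset.mem_range.1 ht
    have hc : ((n - t : ℕ) : ℝ) = ((n - 1 - t : ℕ) : ℝ) + 1 := by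
      rw [← Nat.cast_succ]; congr 1; omega
    rw [hform, hc]
  have h2 : ∑ t ∈ Finset.range n, 1 / (a + 4 * ((n - t : ℕ) : ℝ) ^ 2 / (n : ℝ) ^ 2) ≤
      n / Real.sqrt a := by
    rw [hrefl, ← hrs]
    exact sum_range_inv_sq_add_le' hsa (by positivity) n
  -- first sum: the `t = 0` term is `1/a`, the rest is shifted
  have h1 : ∑ t ∈ Finset.range n, 1 / (a + 4 * (t : ℝ) ^ 2 / (n : ℝ) ^ 2) ≤ 1 / a + n / Real.sqrt a := by
    obtain ⟨m, rfl⟩ : ∃ m, n = m + 1 := ⟨n - 1, by omega⟩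
    rw [Finset.sum_range_succ']
    have h0 : 1 / (a + 4 * ((0 : ℕ) : ℝ) ^ 2 / ((m + 1 : ℕ) : ℝ) ^ 2) = 1 / a := by simp
    rw [h0, add_comm]
    gcongr
    have hm : ∑ j ∈ Finset.range m, 1 / (a + 4 * ((j + 1 : ℕ) : ℝ) ^ 2 / ((m + 1 : ℕ) : ℝ) ^ 2) =
        ∑ j ∈ Finset.range m, 1 / (Real.sqrt a ^ 2 + (2 / ((m + 1 : ℕ) : ℝ)) ^ 2 * ((j : ℝ) + 1) ^ 2) := by
      refine Finset.sum_congr rfl fun j _ => ?_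
      rw [hform]
      push_cast
      ring_nf
    rw [hm]
    calc ∑ j ∈ Finset.range m, 1 / (Real.sqrt a ^ 2 + (2 / ((m + 1 : ℕ) : ℝ)) ^ 2 * ((j : ℝ) + 1) ^ 2)
        ≤ 2 / (2 / ((m + 1 : ℕ) : ℝ) * Real.sqrt a) := sum_range_inv_sq_add_le' hsa (by positivity) m
      _ = ((m + 1 : ℕ) : ℝ) / Real.sqrt a := hrs
  calc ∑ t ∈ Finset.range n, 1 / (a + 4 * (t : ℝ) ^ 2 / (n : ℝ) ^ 2) +
        ∑ t ∈ Finset.range n, 1 / (a + 4 * ((n - t : ℕ) : ℝ) ^ 2 / (n : ℝ) ^ 2)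
      ≤ (1 / a + n / Real.sqrt a) + n / Real.sqrt a := add_le_add h1 h2
    _ = 1 / a + 2 * n / Real.sqrt a := by ring

/-! ### The spatial factor `(ℤ/L)²`: sums of `|k|_∞⁻¹` -/

/-- The weight `g(m) = 1` for `m = 0` and `m^{-1/2}` otherwise, through which `max(m₀,m₁)⁻¹`
factorises. [folklore] -/
theorem inv_max_le_mul (m₀ m₁ : ℕ) :
    (1 : ℝ) / ((max m₀ m₁ : ℕ) : ℝ) ≤
      (if m₀ = 0 then 1 else 1 / Real.sqrt m₀) * (if m₁ = 0 then 1 else 1 / Real.sqrt m₁) := by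
  rcases Nat.eq_zero_or_pos m₀ with h0 | h0 <;> rcases Nat.eq_zero_or_pos m₁ with h1 | h1
  · subst h0; subst h1; simp
  · subst h0
    rw [if_pos rfl, if_neg h1.ne', one_mul, Nat.zero_max]
    have h1' : (1 : ℝ) ≤ m₁ := by exact_mod_cast h1
    have hs : Real.sqrt m₁ ≤ m₁ := by rw [Real.sqrt_le_left (by positivity)]; nlinarith
    exact one_div_le_one_div_of_le (Real.sqrt_pos.2 (by positivity)) hs
  · subst h1
    rw [if_pos rfl, if_neg h0.ne', mul_one, Nat.max_zero]
    have h0' : (1 : ℝ) ≤ m₀ := by exact_mod_cast h0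
    have hs : Real.sqrt m₀ ≤ m₀ := by rw [Real.sqrt_le_left (by positivity)]; nlinarith
    exact one_div_le_one_div_of_le (Real.sqrt_pos.2 (by positivity)) hs
  · rw [if_neg h0.ne', if_neg h1.ne', div_mul_div_comm, one_mul, ← Real.sqrt_mul (by positivity)]
    have h0' : (0 : ℝ) < m₀ := by exact_mod_cast h0
    have h1' : (0 : ℝ) < m₁ := by exact_mod_cast h1
    refine one_div_le_one_div_of_le (Real.sqrt_pos.2 (by positivity)) ?_
    rw [Real.sqrt_le_left (by positivity)]
    rcases le_total m₀ m₁ with h | h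
    · have : (m₀ : ℝ) ≤ m₁ := by exact_mod_cast h
      rw [max_eq_right h]; nlinarith
    · have : (m₁ : ℝ) ≤ m₀ := by exact_mod_cast h
      rw [max_eq_left h]; nlinarith

/-- `g(min(t, L-t)) ≤ t^{-1/2} + (L-t)^{-1/2}` for `1 ≤ t < L`. [folklore] -/
theorem weight_min_le {L t : ℕ} (ht1 : 1 ≤ t) (htL : t < L) :
    (if min t (L - t) = 0 then (1 : ℝ) else 1 / Real.sqrt ((min t (L - t) : ℕ) : ℝ)) ≤
      1 / Real.sqrt t + 1 / Real.sqrt ((L - t : ℕ) : ℝ) := by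
  have hmin : min t (L - t) ≠ 0 := by omega
  rw [if_neg hmin]
  rcases le_total t (L - t) with h | h
  · rw [min_eq_left h]; exact le_add_of_nonneg_right (by positivity)
  · rw [min_eq_right h]; exact le_add_of_nonneg_left (by positivity)

/-- **The one-dimensional weight sum**: `∑_{v ∈ ℤ/L} g(min(v, L-v)) ≤ 1 + 4√L`. [folklore] -/
theorem sum_weight_min_le {L : ℕ} [NeZero L] :
    ∑ v : ZMod L, (if min v.val (L - v.val) = 0 then (1 : ℝ) else
        1 / Real.sqrt ((min v.val (L - v.val) : ℕ) : ℝ)) ≤ 1 + 4 * Real.sqrt L := by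
  have hL : 0 < L := Nat.pos_of_ne_zero (NeZero.ne L)
  rw [sum_zmod_eq_sum_range (fun t => if min t (L - t) = 0 then (1 : ℝ) else
    1 / Real.sqrt ((min t (L - t) : ℕ) : ℝ))]
  obtain ⟨m, rfl⟩ : ∃ m, L = m + 1 := ⟨L - 1, by omega⟩
  rw [Finset.sum_range_succ']
  have h0 : (if min 0 (m + 1 - 0) = 0 then (1 : ℝ) else 1 / Real.sqrt ((min 0 (m + 1 - 0) : ℕ) : ℝ)) = 1 := by
    simp
  rw [h0, add_comm]
  gcongr
  have hpt : ∀ j ∈ Finset.range m,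
      (if min (j + 1) (m + 1 - (j + 1)) = 0 then (1 : ℝ) else
        1 / Real.sqrt ((min (j + 1) (m + 1 - (j + 1)) : ℕ) : ℝ)) ≤
      1 / Real.sqrt ((j : ℝ) + 1) + 1 / Real.sqrt (((m - 1 - j : ℕ) : ℝ) + 1) := by
    intro j hj
    have hj' := Finset.mem_range.1 hj
    have h := weight_min_le (L := m + 1) (t := j + 1) (by omega) (by omega)
    have e1 : ((j + 1 : ℕ) : ℝ) = (j : ℝ) + 1 := by push_cast; ring
    have e2 : ((m + 1 - (j + 1) : ℕ) : ℝ) = ((m - 1 - j : ℕ) : ℝ) + 1 := by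
      rw [← Nat.cast_succ]; congr 1; omega
    rw [e1, e2] at h
    exact h
  refine (Finset.sum_le_sum hpt).trans ?_
  rw [Finset.sum_add_distrib, Finset.sum_range_reflect (fun j => 1 / Real.sqrt ((j : ℝ) + 1)) m]
  have hs := Literature.NumberTheory.LFunctions.RobertSargos.Thm1.sum_inv_sqrt_le m
  have hmono : Real.sqrt (m : ℝ) ≤ Real.sqrt ((m + 1 : ℕ) : ℝ) :=
    Real.sqrt_le_sqrt (by push_cast; linarith)
  linarith

/-- **The two-dimensional sum of `|k|_∞⁻¹`**: with `m(v) = min(v, L - v)` and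
`μ(k) = max(m(k₀), m(k₁))`, `∑_{k ∈ (ℤ/L)²} μ(k)⁻¹ ≤ 25 L` (the `k = 0` term is `0⁻¹ = 0`).
[folklore] -/
theorem sum_inv_maxnorm_le {L : ℕ} [NeZero L] :
    ∑ k : TorusSite 2 L, (1 : ℝ) / ((max (min (k 0).val (L - (k 0).val))
        (min (k 1).val (L - (k 1).val)) : ℕ) : ℝ) ≤ 25 * L := by
  have hL : 0 < L := Nat.pos_of_ne_zero (NeZero.ne L)
  have hL1 : (1 : ℝ) ≤ L := by exact_mod_cast hL
  set g : ZMod L → ℝ := fun v => if min v.val (L - v.val) = 0 then (1 : ℝ) else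
    1 / Real.sqrt ((min v.val (L - v.val) : ℕ) : ℝ) with hg
  have hpt : ∀ k : TorusSite 2 L, (1 : ℝ) / ((max (min (k 0).val (L - (k 0).val))
      (min (k 1).val (L - (k 1).val)) : ℕ) : ℝ) ≤ g (k 0) * g (k 1) := fun k => inv_max_le_mul _ _
  refine (Finset.sum_le_sum fun k _ => hpt k).trans ?_
  have hprod : ∑ k : TorusSite 2 L, g (k 0) * g (k 1) = (∑ v : ZMod L, g v) * (∑ v : ZMod L, g v) := by
    rw [Fintype.sum_equiv (finTwoArrowEquiv (ZMod L)) (fun k => g (k 0) * g (k 1))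
      (fun p => g p.1 * g p.2) (fun k => by simp), Fintype.sum_prod_type, Finset.sum_mul_sum]
  rw [hprod]
  have hG := sum_weight_min_le (L := L)
  have hG0 : 0 ≤ ∑ v : ZMod L, g v := Finset.sum_nonneg fun v _ => by
    rw [hg]; simp only; split_ifs <;> positivity
  have hsq : Real.sqrt (L : ℝ) ^ 2 = L := Real.sq_sqrt (by positivity)
  have hsL : 1 ≤ Real.sqrt (L : ℝ) := by rw [Real.le_sqrt (by norm_num) (by positivity)]; simpa using hL1
  calc (∑ v : ZMod L, g v) * (∑ v : ZMod L, g v) ≤ (1 + 4 * Real.sqrt L) * (1 + 4 * Real.sqrt L) :=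
        mul_le_mul hG hG hG0 (by positivity)
    _ ≤ (5 * Real.sqrt L) * (5 * Real.sqrt L) := by nlinarith
    _ = 25 * L := by nlinarith

/-! ### The anisotropic dispersion and the final bound -/

/-- **Lower bound on the spatial dispersion**: `4μ(k)²/L² ≤ ε(2πk/L)` on `(ℤ/L)²`. [folklore] -/
theorem maxnorm_sq_le_dispersion {L : ℕ} [NeZero L] (k : TorusSite 2 L) :
    4 * ((max (min (k 0).val (L - (k 0).val)) (min (k 1).val (L - (k 1).val)) : ℕ) : ℝ) ^ 2 /
        (L : ℝ) ^ 2 ≤ dispersion (latticeMomentum L k) := by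
  have hL : 0 < L := Nat.pos_of_ne_zero (NeZero.ne L)
  have hdisp : dispersion (latticeMomentum L k) =
      (1 - Real.cos (2 * π * ((k 0).val : ℝ) / L)) + (1 - Real.cos (2 * π * ((k 1).val : ℝ) / L)) := by
    unfold dispersion latticeMomentum
    rw [Fin.sum_univ_two]
  have h0 := four_mul_sq_min_div_le hL (ZMod.val_lt (k 0))
  have h1 := four_mul_sq_min_div_le hL (ZMod.val_lt (k 1))
  have hc0 : 0 ≤ 1 - Real.cos (2 * π * ((k 0).val : ℝ) / L) := sub_nonneg.2 (Real.cos_le_one _)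
  have hc1 : 0 ≤ 1 - Real.cos (2 * π * ((k 1).val : ℝ) / L) := sub_nonneg.2 (Real.cos_le_one _)
  rw [hdisp]
  rcases le_total (min (k 0).val (L - (k 0).val)) (min (k 1).val (L - (k 1).val)) with h | h
  · rw [max_eq_right h]; linarith
  · rw [max_eq_left h]; linarith

/-- For `k ≠ 0` in `(ℤ/L)²`, `μ(k) ≥ 1`. [folklore] -/
theorem one_le_maxnorm {L : ℕ} [NeZero L] {k : TorusSite 2 L} (hk : k ≠ 0) :
    1 ≤ max (min (k 0).val (L - (k 0).val)) (min (k 1).val (L - (k 1).val)) := by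
  have hex : ∃ i, k i ≠ 0 := by
    by_contra h
    push Not at h
    exact hk (funext h)
  obtain ⟨i, hi⟩ := hex
  have hv : (k i).val ≠ 0 := fun h => hi ((ZMod.val_eq_zero (k i)).1 h)
  have hlt := ZMod.val_lt (k i)
  fin_cases i
  · exact le_max_of_le_left (by simp only [Fin.zero_eta] at hv hlt; omega)
  · exact le_max_of_le_right (by simp only [Fin.mk_one] at hv hlt; omega)

/-- **The anisotropic Riemann sum is bounded**: for `1 ≤ L ≤ M`,
`∑_{k ≠ 0} ∑_q (ε(2πk/L) + ε(2πq/M))⁻¹ ≤ 32 L² M` on `(ℤ/L)² × (ℤ/M)`, i.e. the defect of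
slice order in the infrared bound is `O(1/K)` uniformly in the anisotropy `M ≥ L` (the sum over
`q` costs `ε_s⁻¹ + 2M ε_s^{-1/2}`, and `∑_{k≠0} ε_s^{-1/2} = O(L²)`, `∑_{k≠0} ε_s⁻¹ = O(L³) ≤ O(L²M)`).
[folklore] -/
theorem dispersion_sum_bound {L M : ℕ} [NeZero L] [NeZero M] (hLM : L ≤ M) :
    ∑ k ∈ Finset.univ.erase (0 : TorusSite 2 L), ∑ q : TorusSite 1 M,
        1 / (dispersion (latticeMomentum L k) + dispersion (latticeMomentum M q)) ≤
      32 * (L : ℝ) ^ 2 * M := by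
  have hL : 0 < L := Nat.pos_of_ne_zero (NeZero.ne L)
  have hL' : (0 : ℝ) < L := by exact_mod_cast hL
  have hLM' : (L : ℝ) ≤ M := by exact_mod_cast hLM
  -- abbreviations
  set μ : TorusSite 2 L → ℕ := fun k =>
    max (min (k 0).val (L - (k 0).val)) (min (k 1).val (L - (k 1).val)) with hμ
  -- the sum over `q` is the one-dimensional sum
  have hq : ∀ k : TorusSite 2 L, ∑ q : TorusSite 1 M,
      1 / (dispersion (latticeMomentum L k) + dispersion (latticeMomentum M q)) =
        ∑ v : ZMod M, 1 / (dispersion (latticeMomentum L k) +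
          (1 - Real.cos (2 * π * (v.val : ℝ) / M))) := by
    intro k
    refine Fintype.sum_equiv (Equiv.funUnique (Fin 1) (ZMod M)) _ _ fun q => ?_
    unfold dispersion latticeMomentum
    simp
  -- pointwise bound for `k ≠ 0`
  have hk : ∀ k ∈ Finset.univ.erase (0 : TorusSite 2 L), ∑ q : TorusSite 1 M,
      1 / (dispersion (latticeMomentum L k) + dispersion (latticeMomentum M q)) ≤
        ((L : ℝ) ^ 2 / 4 + M * L) * (1 / (μ k : ℝ)) := by
    intro k hkmem
    have hk0 : k ≠ 0 := Finset.ne_of_mem_erase hkmem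
    have hμ1 : (1 : ℝ) ≤ μ k := by exact_mod_cast one_le_maxnorm hk0
    have hμpos : (0 : ℝ) < μ k := by linarith
    set ε : ℝ := dispersion (latticeMomentum L k) with hε
    have hεlow : 4 * (μ k : ℝ) ^ 2 / (L : ℝ) ^ 2 ≤ ε := maxnorm_sq_le_dispersion k
    have h4 : 0 < 4 * (μ k : ℝ) ^ 2 / (L : ℝ) ^ 2 := by positivity
    have hεpos : 0 < ε := lt_of_lt_of_le h4 hεlow
    rw [hq k]
    refine (sum_inv_add_one_sub_cos_le (n := M) hεpos).trans ?_
    -- `1/ε ≤ L²/(4μ²) ≤ L²/(4μ)` and `2M/√ε ≤ ML/μ`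
    have hsqrt : 2 * (μ k : ℝ) / L ≤ Real.sqrt ε := by
      rw [Real.le_sqrt (by positivity) hεpos.le]
      calc (2 * (μ k : ℝ) / L) ^ 2 = 4 * (μ k : ℝ) ^ 2 / (L : ℝ) ^ 2 := by ring
        _ ≤ ε := hεlow
    have hsqpos : 0 < 2 * (μ k : ℝ) / L := by positivity
    have hA : 1 / ε ≤ (L : ℝ) ^ 2 / 4 * (1 / (μ k : ℝ)) := by
      calc 1 / ε ≤ 1 / (4 * (μ k : ℝ) ^ 2 / (L : ℝ) ^ 2) := one_div_le_one_div_of_le h4 hεlow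
        _ = (L : ℝ) ^ 2 / 4 * (1 / (μ k : ℝ)) * (1 / (μ k : ℝ)) := by
            field_simp
        _ ≤ (L : ℝ) ^ 2 / 4 * (1 / (μ k : ℝ)) * 1 := by
            refine mul_le_mul_of_nonneg_left ?_ (by positivity)
            rw [div_le_one hμpos]
            exact hμ1
        _ = (L : ℝ) ^ 2 / 4 * (1 / (μ k : ℝ)) := mul_one _
    have hB : 2 * (M : ℝ) / Real.sqrt ε ≤ M * L * (1 / (μ k : ℝ)) := by
      calc 2 * (M : ℝ) / Real.sqrt ε ≤ 2 * (M : ℝ) / (2 * (μ k : ℝ) / L) :=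
            div_le_div_of_nonneg_left (by positivity) hsqpos hsqrt
        _ = M * L * (1 / (μ k : ℝ)) := by
            field_simp
    linarith
  -- sum the pointwise bound, extend to all `k`, and use the two-dimensional sum
  have hnonneg : ∀ k : TorusSite 2 L, 0 ≤ ((L : ℝ) ^ 2 / 4 + M * L) * (1 / (μ k : ℝ)) :=
    fun k => by positivity
  calc ∑ k ∈ Finset.univ.erase (0 : TorusSite 2 L), ∑ q : TorusSite 1 M,
        1 / (dispersion (latticeMomentum L k) + dispersion (latticeMomentum M q))
      ≤ ∑ k ∈ Finset.univ.erase (0 : TorusSite 2 L), ((L : ℝ) ^ 2 / 4 + M * L) * (1 / (μ k : ℝ)) :=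
        Finset.sum_le_sum hk
    _ ≤ ∑ k : TorusSite 2 L, ((L : ℝ) ^ 2 / 4 + M * L) * (1 / (μ k : ℝ)) :=
        Finset.sum_le_sum_of_subset_of_nonneg (Finset.erase_subset _ _) fun k _ _ => hnonneg k
    _ = ((L : ℝ) ^ 2 / 4 + M * L) * ∑ k : TorusSite 2 L, 1 / (μ k : ℝ) := by rw [Finset.mul_sum]
    _ ≤ ((L : ℝ) ^ 2 / 4 + M * L) * (25 * L) :=
        mul_le_mul_of_nonneg_left sum_inv_maxnorm_le (by positivity)
    _ ≤ 32 * (L : ℝ) ^ 2 * M := by nlinarith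

end BirSliceXY

end Summit.HubbardSuperconductivity.HubbardSuperconductivity.Theorems
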